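import Summits.BirchSwinnertonDyer.BirchSwinnertonDyer.Theorems.ClassRecordThreeKolyvaginShaOrderDivisibleEnd
import HarnessLib

/-!
# Crux `EulerHalfNotRamNoInertSetAtFive` (item stmt-BirchSwinnertonDyer-19715), S1b branch OVER AN hGZ RECEPTACLE — sites (iii)–(iv):
# McCallum 1991 Cor. 5.6 (upper half under global divisibility) AT ONE CURVE, with [GZ86 III (3.1)] replaced by a (W,K)-RECEPTACLE

Cell `bsd-stepL`, seat `bsd-line-er5-p1-w2` g6 (D-0154 width seat -w2; LEAD `bsd-line-er5-p1` g3), `--supports stmt-BirchSwinnertonDyer-19715`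
(helper). THEOREMS ONLY (no definition, no named fact, no `sorry`). Companion of `…JetchevAtPSupplyOfHGZ` ∕ `…JetchevAtPSwapEndOfHGZ` (sites (i)–(ii)).

WHY. In crux 19715's S1b consumer the McCallum Cor. 5.6 upper bound `hMcU` is the NAMED FACT
`McCallum1991_padicValNat_card_sha_primary_add_le_of_globalDivisibility`, derived by tam3-p1 g9 (`…ClassRecordThreeKolyvaginShaOrderDivisibleEnd`) from
{Cassels–Tate level inputs, Gross Prop. 3.7 (2), [GZ86 III (3.1)] `hE0`}; `hE0` enters at two sites, both through x11b3's per-frame hGZ binder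
(`KolyvaginHloc.hGZ_of_gross1991E0`): (iii) `KolyvaginOrder.card_sha_primary_le_at_of_divT_frame_…` and (iv)
`KolyvaginDischarged.pow_smul_sha_primary_eq_zero_at_of_gross1991E0_of_prop37`. Width seat -w5 g0's «modular aux-norm» supplies an hGZ receptacle in
cell bsd-jet's shape at every frame of an S1b curve; this file re-keys (iii), (iv) and the McCallum bound AT ONE CURVE over that receptacle (a named
fact quantifies over all curves and cannot be fed a per-curve supply, hence the pointwise form). Proof texts = the originals' with `hE0` ↦ receptacle.
  -- adapted from Summits/BirchSwinnertonDyer/BirchSwinnertonDyer/Theorems/ClassRecordThreeKolyvaginShaOrderDivisibleEnd.lean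
* `KolyvaginDischarged.hGZ_of_receptacle` — the BRIDGE bsd-jet shape ⟹ x11b3's per-frame Hloc binder (Gross ⟹ Zhang primes by
  `McCallum1991.le_kolyvaginIndex_of_frobEqFrobInfty`); `…pow_smul_sha_primary_eq_zero_at_of_hGZ_of_prop37` — site (iv);
  site (iii) INLINED in the last theorem over x11b3's hGZ-keyed `hpoints_at_of_perLevelChoice_of_divT_frame`;
  **`KolyvaginOrder.padicValNat_card_sha_primary_add_le_at_of_globalDivisibility_of_casselsTate_of_prop37_of_hGZ`** — McCallum Cor. 5.6 upper AT
  `(W, K, p)` and a conductor-1 frame, from the two named facts + the receptacle (the named fact's body with its ∀-prefix as binders).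

HONEST FRAMING: CONDITIONAL on the displayed named facts (`casselsTate_levelInputs`, `prop37_2_reductionCongruence`) and on the receptacle hypothesis;
nothing booked; no census label moves (T7); crux 19715 is NOT closed by this helper; no summit statement is touched; BSD is proved for no curve.
[cite: McCallumLMS1991, §5 Cor. 5.6] [cite: GrossLMS1991, §3 (3.1)–(3.3), Prop. 3.7 (2), §6] [cite: GrossZagier1986, III (3.1)] [cite: WZhang2014, Notations (xii)]
-/

noncomputable section

open scoped Classical Pointwise

/-! ## §1 The bridge and site (iv) -/
namespace Summit.BirchSwinnertonDyer.Rank1Residual.X11b.KolyvaginDischarged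
open WeierstrassCurve Field NumberField IsDedekindDomain
open Literature.NumberTheory.EllipticCurves Literature.NumberTheory.GaloisRepresentations
open Literature.NumberTheory.EllipticCurves.RingClassField
open Literature.NumberTheory.EllipticCurves.ModularForms
open Literature.NumberTheory.EllipticCurves.GrossLMS1991 (prop37_2_reductionCongruence)
open Literature.NumberTheory.GaloisCohomology (poitouTate_sum_localTatePairing_eq_zero_holds)
open Summit.BirchSwinnertonDyer.Rank1Residual.X11b.KolyvaginAssembly

-- `K : Type`: the tree's ring-class class field theory is universe `0`.
variable {K : Type} [Field K] [NumberField K] {N : ℕ} {W : WeierstrassCurve ℚ}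

/-- **JET shape ⟹ Hloc shape (the bridge).** bsd-jet's (W,K)-receptacle (`∃ n'` prime to `p`, every squarefree W.-Zhang–Kolyvagin level, every
datum) yields x11b3's per-frame binder (`∃ n'` prime to `p^M`, data `d m`, `m ∣ n`, Gross–Kolyvagin level `n` at `p^M`): `IsCoprime.pow_left`; `m ∣ n`
squarefree; a Gross Kolyvagin prime with `Frob = Frob(∞)` on `K(E[p^M])`, `M ≥ 1`, has Zhang index `≥ M` (`McCallum1991.le_kolyvaginIndex_of_frobEqFrobInfty`).
[cite: GrossLMS1991, §3 (3.1)–(3.3)] [cite: WZhang2014, Notations (xii)] -/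
theorem hGZ_of_receptacle (W : WeierstrassCurve ℚ) [NeZero N] [W.IsElliptic] [W.IsGloballyMinimal]
    (hN : N = W.conductorNorm ℤ) {p : ℕ} (hp : p.Prime)
    (hRcp : ∀ (Dt : ModularParametrizationData W N) (β : ℤ) (ι : K →+* ℂ),
      ∃ n' : ℤ, IsCoprime (p : ℤ) n' ∧ ∀ (m : ℕ), Squarefree m →
        (∀ q ∈ m.primeFactors, Zhang2014.IsKolyvaginPrime N W K p q) →
        ∀ (dm : KolyvaginHeegnerData Dt β ι m)
          (γ : ringClassField K ι m ≃ₐ[ℚ] ringClassField K ι m), γ ∈ ringClassGal ι m →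
          ∀ v : HeightOneSpectrum (𝓞 K), ¬ (W.baseChange K).HasGoodReductionAt v →
            n' • pointsMap (W.baseChange K) (v.adicCompletion K)
                (dm.toGeomPoints (pointGalHom W (ringClassField K ι m) γ dm.y)) ∈
              E0Receptacle (W.baseChange K) v ∧
            ∀ (ℓ : ℕ), ℓ ∈ m.primeFactors → ∀ (dm' : KolyvaginHeegnerData Dt β ι (m / ℓ))
              (hle : ringClassField K ι (m / ℓ) ≤ ringClassField K ι m),
              n' • pointsMap (W.baseChange K) (v.adicCompletion K)
                  (dm.toGeomPoints (pointGalHom W (ringClassField K ι m) γ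
                    (WeierstrassCurve.Affine.Point.map (W' := W)
                      ((RingClassField.inclusion ι hle).restrictScalars ℚ) dm'.y))) ∈
                E0Receptacle (W.baseChange K) v)
    (Dt : ModularParametrizationData W N) (β : ℤ) (ι : K →+* ℂ) {M : ℕ} (hM : 1 ≤ M) {n : ℕ}
    (hn : Squarefree n)
    (hKol : ∀ q ∈ n.primeFactors, IsKolyvaginPrime N W K p q ∧ FrobEqFrobInfty W K (p ^ M) q)
    (d : (m : ℕ) → m ∣ n → KolyvaginHeegnerData Dt β ι m) :
    ∃ n' : ℤ, IsCoprime ((p ^ M : ℕ) : ℤ) n' ∧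
      ∀ (m : ℕ) (hm : m ∣ n) (γ : ringClassField K ι m ≃ₐ[ℚ] ringClassField K ι m),
        γ ∈ ringClassGal ι m → ∀ v : HeightOneSpectrum (𝓞 K),
          ¬ (W.baseChange K).HasGoodReductionAt v →
          n' • pointsMap (W.baseChange K) (v.adicCompletion K)
              ((d m hm).toGeomPoints (pointGalHom W (ringClassField K ι m) γ (d m hm).y)) ∈
            E0Receptacle (W.baseChange K) v ∧
          ∀ (ℓ : ℕ) (hℓ : ℓ ∈ m.primeFactors)
            (hle : ringClassField K ι (m / ℓ) ≤ ringClassField K ι m),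
            n' • pointsMap (W.baseChange K) (v.adicCompletion K)
                ((d m hm).toGeomPoints (pointGalHom W (ringClassField K ι m) γ
                  (WeierstrassCurve.Affine.Point.map (W' := W)
                    ((RingClassField.inclusion ι hle).restrictScalars ℚ)
                    (d (m / ℓ)
                      ((Nat.div_dvd_of_dvd (Nat.dvd_of_mem_primeFactors hℓ)).trans hm)).y))) ∈
              E0Receptacle (W.baseChange K) v := by
  subst hN
  obtain ⟨n', hcop, h⟩ := hRcp Dt β ι
  refine ⟨n', ?_, fun m hm γ hγ v hv ↦ ?_⟩
  · rw [Nat.cast_pow]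
    exact hcop.pow_left
  have hmK : ∀ q ∈ m.primeFactors, Zhang2014.IsKolyvaginPrime (W.conductorNorm ℤ) W K p q := by
    intro q hq
    obtain ⟨⟨hqP, hqN, hqD, hqp, hprime, -⟩, hfrob⟩ := hKol q (Nat.primeFactors_mono hm hn.ne_zero hq)
    exact ⟨hqP, hqN, hqD, hqp, hprime,
      lt_of_lt_of_le hM (McCallum1991.le_kolyvaginIndex_of_frobEqFrobInfty W K hp hM hqP hqp hqN hfrob)⟩
  obtain ⟨h1, h2⟩ := h m (hn.squarefree_of_dvd hm) hmK (d m hm) γ hγ v hv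
  exact ⟨h1, fun ℓ hℓ hle ↦ h2 ℓ hℓ (d (m / ℓ) ((Nat.div_dvd_of_dvd (Nat.dvd_of_mem_primeFactors hℓ)).trans hm)) hle⟩

/-- **Kolyvagin's annihilator at ONE odd surjective prime `p`, OVER THE hGZ RECEPTACLE: `p^{m+1} ∤ y_K ⟹ p^{m} · Ш(E/K)[p^∞] = 0`** — x11b3's
`KolyvaginDischarged.pow_smul_sha_primary_eq_zero_at_of_gross1991E0_of_prop37` with `hE0` replaced by the (W,K)-receptacle (level `N`): the hGZ-keyed
parent `KolyvaginAnnihilator.…_of_leafInputs_of_poitouTate` with `hPT`, `hrec`, `hCM`, `h53` from the tree theorems (as there), `hGZ := hGZ_of_receptacle`,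
`hγ := hγ.endBinder`; `[W.IsElliptic]` is theorem-level here. CONDITIONAL on `hγ` + the receptacle + `hN`; nothing booked.
[cite: McCallumLMS1991, §1 Theorem (Kolyvagin), §2 Prop. 2.2, Lemma 5.1] [cite: GrossLMS1991, Thm. 1.3 (2), §3 Prop. 3.7 (2), §6 Prop. 6.2 (1)] -/
theorem pow_smul_sha_primary_eq_zero_at_of_hGZ_of_prop37 [NeZero N] [W.IsGloballyMinimal] [W.IsElliptic]
    {p : ℕ} (hp : p.Prime) (hp2 : p ≠ 2) (hN : N = W.conductorNorm ℤ)
    (hRcp : ∀ (Dt : ModularParametrizationData W N) (β : ℤ) (ι : K →+* ℂ),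
      ∃ n' : ℤ, IsCoprime (p : ℤ) n' ∧ ∀ (m : ℕ), Squarefree m →
        (∀ q ∈ m.primeFactors, Zhang2014.IsKolyvaginPrime N W K p q) →
        ∀ (dm : KolyvaginHeegnerData Dt β ι m)
          (γ : ringClassField K ι m ≃ₐ[ℚ] ringClassField K ι m), γ ∈ ringClassGal ι m →
          ∀ v : HeightOneSpectrum (𝓞 K), ¬ (W.baseChange K).HasGoodReductionAt v →
            n' • pointsMap (W.baseChange K) (v.adicCompletion K)
                (dm.toGeomPoints (pointGalHom W (ringClassField K ι m) γ dm.y)) ∈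
              E0Receptacle (W.baseChange K) v ∧
            ∀ (ℓ : ℕ), ℓ ∈ m.primeFactors → ∀ (dm' : KolyvaginHeegnerData Dt β ι (m / ℓ))
              (hle : ringClassField K ι (m / ℓ) ≤ ringClassField K ι m),
              n' • pointsMap (W.baseChange K) (v.adicCompletion K)
                  (dm.toGeomPoints (pointGalHom W (ringClassField K ι m) γ
                    (WeierstrassCurve.Affine.Point.map (W' := W)
                      ((RingClassField.inclusion ι hle).restrictScalars ℚ) dm'.y))) ∈
                E0Receptacle (W.baseChange K) v)
    (hγ : prop37_2_reductionCongruence N W K p)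
    (hE : ¬ W.HasCM) (hK : IsImaginaryQuadratic K) (hD : NumberField.discr K ≠ -3 ∧ NumberField.discr K ≠ -4)
    (hH : SatisfiesHeegnerHypothesis N K) {P : (W.baseChange K).toAffine.Point} (hP : IsHeegnerPoint N W K P)
    (hnt : ¬ IsOfFinAddOrder P) (hρ : W.HasSurjectiveModNGaloisRep p) {m : ℕ}
    (hm : ∀ Q : (W.baseChange K).toAffine.Point, p ^ (m + 1) • Q ≠ P) (c : (W.baseChange K).sha)
    (hc : ∃ j : ℕ, p ^ j • c = 0) : p ^ m • c = 0 :=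
  KolyvaginAnnihilator.pow_smul_sha_primary_eq_zero_at_of_leafInputs_of_poitouTate hp hp2
    (poitouTate_sum_localTatePairing_eq_zero_holds K) (@fun _ ↦ hN)
    (heegnerPointOfConductor_one_galoisConj_holds N W K) (KolyvaginLeaves.hCM_holds N W K p)
    (@fun _ ↦ KolyvaginLeaves.h53_holds hN p)
    (@fun _ _ _ Dt β ι _ hM _ hn hKol d ↦ hGZ_of_receptacle W hN hp hRcp Dt β ι hM hn hKol d)
    (hγ.endBinder (@fun _ ↦ hE) hD hp hp2 (@fun _ ↦ hρ) (@fun _ ↦ hN)) hE hK hD hH hP hnt hρ hm c hc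

end Summit.BirchSwinnertonDyer.Rank1Residual.X11b.KolyvaginDischarged

/-! ## §2 McCallum Cor. 5.6 (upper, under global divisibility) at one curve — site (iii) inlined -/

namespace Summit.BirchSwinnertonDyer.Rank1Residual.X11b.KolyvaginOrder
open WeierstrassCurve NumberField IsDedekindDomain Field Function
open Literature.NumberTheory.EllipticCurves Literature.NumberTheory.EllipticCurves.KolyvaginDescent
open Literature.NumberTheory.EllipticCurves.KolyvaginCocycle
open Literature.NumberTheory.EllipticCurves.RingClassField
open Literature.NumberTheory.EllipticCurves.ModularForms
open Literature.NumberTheory.GaloisRepresentations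
open Literature.NumberTheory.GaloisCohomology
open Literature.NumberTheory.GaloisRepresentations.DiscreteGaloisModule (mu MuCarrier)
open Literature.NumberTheory.EllipticCurves.GrossLMS1991 (prop37_2_reductionCongruence)
open Summit.BirchSwinnertonDyer.Rank1Residual.X11b.KolyvaginAssembly
open Summit.BirchSwinnertonDyer.Rank1Residual.X11b.KolyvaginCT


/-- **McCallum 1991 Cor. 5.6, upper half under global divisibility, AT ONE CURVE AND ONE FIELD, OVER THE hGZ RECEPTACLE** — the body of the
named fact `McCallum1991_padicValNat_card_sha_primary_add_le_of_globalDivisibility` at `(W, K, p)` and one conductor-1 frame («Tamagawa-absorbing» bound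
`ord_p #Ш(E/K)[p^∞] + 2t ≤ 2 ord_p [E(K) : ℤ y_K]` under global `p^s`-divisibility of the derived points for `s ≤ t`), DERIVED from
{`casselsTate_levelInputs`, `prop37_2_reductionCongruence`} and the (W,K)-receptacle `hRcp` in place of [GZ86 III (3.1)] — tam3-p1 g9's
`McCallum1991_…_of_casselsTate_of_prop37_of_E0` with the ∀-prefix as binders, `hE0` ↦ `hRcp`, its two `hE0`-consumers re-keyed (site (iv) `pow_smul_…_of_hGZ_of_prop37`; site (iii) inlined over x11b3's
hGZ-keyed `card_sha_primary_le_at_of_pointsMDiv_of_reciprocityFinset_of_localDuality` ∘ `hpoints_at_of_perLevelChoice_of_divT_frame`, the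
Cassels–Tate local instances being carried by the callee's types); every other line VERBATIM. CONDITIONAL; nothing booked. [cite: McCallumLMS1991, §1 Theorem, §4 Cor. 4.5, §5 Lemma 5.1, Thm. 5.4, Cor. 5.6 (p. 310)]
[cite: Jetchev2008, p. 812 (1) and Cor. 1.5] [cite: GrossLMS1991, §3 Prop. 3.7 (2), §4 (4.1)] [cite: MilneADT2006, Ch. I §6, Prop. 6.9, Thm. 6.13(a)] -/
theorem padicValNat_card_sha_primary_add_le_at_of_globalDivisibility_of_casselsTate_of_prop37_of_hGZ
    (hCTf : ∀ (K : Type) [Field K] [NumberField K], casselsTate_levelInputs K)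
    (hγf : ∀ (N : ℕ) [NeZero N] (W : WeierstrassCurve ℚ) [W.IsGloballyMinimal]
      (K : Type) [Field K] [NumberField K] (p : ℕ), GrossLMS1991.prop37_2_reductionCongruence N W K p)
    (W : WeierstrassCurve ℚ) [W.IsElliptic] [W.IsGloballyMinimal] [NeZero (W.conductorNorm ℤ)]
    (hE : ¬ W.HasCM) (K : Type) [Field K] [NumberField K] (hK : IsImaginaryQuadratic K)
    (hD3 : NumberField.discr K ≠ -3) (hD4 : NumberField.discr K ≠ -4)
    (hH : SatisfiesHeegnerHypothesis (W.conductorNorm ℤ) K)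
    (p : ℕ) [Fact p.Prime] (hp2 : p ≠ 2) (htower : ∀ n : ℕ, W.HasSurjectiveModNGaloisRep (p ^ n : ℕ))
    (hRcp : ∀ (Dt : ModularParametrizationData W (W.conductorNorm ℤ)) (β : ℤ) (ι : K →+* ℂ),
      ∃ n' : ℤ, IsCoprime (p : ℤ) n' ∧ ∀ (m : ℕ), Squarefree m →
        (∀ q ∈ m.primeFactors, Zhang2014.IsKolyvaginPrime (W.conductorNorm ℤ) W K p q) →
        ∀ (dm : KolyvaginHeegnerData Dt β ι m)
          (γ : ringClassField K ι m ≃ₐ[ℚ] ringClassField K ι m), γ ∈ ringClassGal ι m →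
          ∀ v : HeightOneSpectrum (𝓞 K), ¬ (W.baseChange K).HasGoodReductionAt v →
            n' • pointsMap (W.baseChange K) (v.adicCompletion K)
                (dm.toGeomPoints (pointGalHom W (ringClassField K ι m) γ dm.y)) ∈
              E0Receptacle (W.baseChange K) v ∧
            ∀ (ℓ : ℕ), ℓ ∈ m.primeFactors → ∀ (dm' : KolyvaginHeegnerData Dt β ι (m / ℓ))
              (hle : ringClassField K ι (m / ℓ) ≤ ringClassField K ι m),
              n' • pointsMap (W.baseChange K) (v.adicCompletion K)
                  (dm.toGeomPoints (pointGalHom W (ringClassField K ι m) γ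
                    (WeierstrassCurve.Affine.Point.map (W' := W)
                      ((RingClassField.inclusion ι hle).restrictScalars ℚ) dm'.y))) ∈
                E0Receptacle (W.baseChange K) v)
    (Dt : ModularParametrizationData W (W.conductorNorm ℤ)) (β : ℤ) (ι : K →+* ℂ)
    (d₁ : KolyvaginHeegnerData Dt β ι 1) (P : (W.baseChange K).toAffine.Point)
    (hP1 : d₁.toGeomPoints d₁.derivedPoint = toGeomPoints (W.baseChange K) P)
    (hnt : ¬ IsOfFinAddOrder P) (M₀ : ℕ)
    (hM₀div : ∃ Q : (W.baseChange K).toAffine.Point, ((p ^ M₀ : ℕ) : ℤ) • Q = P)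
    (hM₀max : ¬ ∃ Q : (W.baseChange K).toAffine.Point, ((p ^ (M₀ + 1) : ℕ) : ℤ) • Q = P)
    (t : ℕ)
    (hglob : ∀ (s : ℕ), s ≤ t → ∀ (n : ℕ) (d : KolyvaginHeegnerData Dt β ι n), Squarefree n →
      (∀ ℓ ∈ n.primeFactors, Zhang2014.IsKolyvaginPrime (W.conductorNorm ℤ) W K p ℓ ∧
        s ≤ Zhang2014.kolyvaginIndex W p ℓ) →
      ∃ Q : (W.baseChange (ringClassField K ι n)).toAffine.Point,
        ((p ^ s : ℕ) : ℤ) • Q = d.derivedPoint) :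
    padicValNat p (Nat.card (AddCommGroup.primaryComponent (W.baseChange K).sha p)) + 2 * t ≤ 2 * M₀ := by
  have hp : p.Prime := Fact.out
  have hρ : W.HasSurjectiveModNGaloisRep p := by simpa using htower 1
  have hD34 : NumberField.discr K ≠ -3 ∧ NumberField.discr K ≠ -4 := ⟨hD3, hD4⟩
  have hrec := heegnerPointOfConductor_one_galoisConj_holds (W.conductorNorm ℤ) W K
  -- `P ↔ P(1)` on the fact's frame
  have hmapP : WeierstrassCurve.Affine.Point.map (W' := W)
      (algebraMap K (ringClassField K ι 1)).toRatAlgHom P = d₁.derivedPoint := by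
    apply WeierstrassCurve.Affine.Point.map_injective (W' := W) d₁.emb.toRatAlgHom
    change d₁.toGeomPoints _ = d₁.toGeomPoints _
    rw [KolyvaginBottom.toGeomPoints_map_algebraMap d₁ P, hP1]
  -- the Heegner display of `P` on THIS frame (Shimura reciprocity at conductor `1`)
  obtain ⟨H, hHβ⟩ := exists_heegnerDatum (W.conductorNorm ℤ) hK.discr_neg d₁.dvd_sq_sub
  have hPH : WeierstrassCurve.Affine.Point.map (W' := W) ι.toRatAlgHom P = heegnerPointComplex Dt H := by
    obtain ⟨e1, he1⟩ := hrec hK hH Dt β ι d₁ H hHβ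
    have hι : ι.toRatAlgHom = (ringClassField K ι 1).subtype.toRatAlgHom.comp
        (algebraMap K (ringClassField K ι 1)).toRatAlgHom := by
      ext x
      rfl
    rw [hι, ← WeierstrassCurve.Affine.Point.map_map, hmapP, d₁.derivedPoint_one, map_sum,
      heegnerPointComplex, ← Finset.sum_coe_sort H.reps, ← Finset.sum_coe_sort d₁.S]
    exact Fintype.sum_equiv e1 _ _ fun s ↦ he1 s
  have hHP : IsHeegnerPoint (W.conductorNorm ℤ) W K P := ⟨Dt, H, ι, hPH⟩
  have hc1 : ∀ d : KolyvaginHeegnerData Dt β ι 1,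
      d.toGeomPoints d.derivedPoint = (W.baseChange K).toGeomPoints P :=
    fun d ↦ KolyvaginBottom.toGeomPoints_derivedPoint_one_eq hrec hK hH hPH d hHβ
  -- the class-form divisibility on the frame, from the fact's global divisibility at depth `min M t`
  have hDivT : ∀ {M : ℕ} (_hM : 1 ≤ M) {n : ℕ} (_hn : Squarefree n)
      (_hKol : ∀ q ∈ n.primeFactors, IsKolyvaginPrime (W.conductorNorm ℤ) W K p q ∧
        FrobEqFrobInfty W K (p ^ M) q)
      (d : (m : ℕ) → m ∣ n → KolyvaginHeegnerData Dt β ι m),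
      ((p : ℤ) ^ (M - t)) • (d n dvd_rfl).kolyvaginClass hp M = 0 := by
    intro M hM n hn hKol d
    have hZ : ∀ ℓ ∈ n.primeFactors, Zhang2014.IsKolyvaginPrime (W.conductorNorm ℤ) W K p ℓ ∧
        min M t ≤ Zhang2014.kolyvaginIndex W p ℓ := by
      intro ℓ hℓ
      obtain ⟨⟨hℓP, hℓN, hℓD, hℓp, hprime, -⟩, hfrob⟩ := hKol ℓ hℓ
      have hidx : M ≤ Zhang2014.kolyvaginIndex W p ℓ :=
        McCallum1991.le_kolyvaginIndex_of_frobEqFrobInfty W K hp hM hℓP hℓp hℓN hfrob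
      exact ⟨⟨hℓP, hℓN, hℓD, hℓp, hprime, lt_of_lt_of_le (by omega) hidx⟩, (min_le_left _ _).trans hidx⟩
    obtain ⟨Q, hQ⟩ := hglob (min M t) (min_le_right M t) n (d n dvd_rfl) hn hZ
    set dn := d n dvd_rfl with hdn
    by_cases hadm : KolyvaginCocycle.IsAdmissible (Field.absoluteGaloisGroup K) dn.pointsSubgroup
          ((p ^ M : ℕ) : ℤ) ∧
        dn.toGeomPoints dn.derivedPoint ∈
          KolyvaginCocycle.invPoints (Field.absoluteGaloisGroup K) dn.pointsSubgroup ((p ^ M : ℕ) : ℤ)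
    swap
    · rw [KolyvaginHeegnerData.kolyvaginClass, dif_neg hadm, zsmul_zero]
    obtain ⟨hA, hP⟩ := hadm
    rw [KolyvaginHeegnerData.kolyvaginClass_of_admissible _ hp M hA hP]
    obtain ⟨Q0, hQ0⟩ := (W.baseChange K).zsmul_geomPoints_surjective_of_charZero
      (n := ((p ^ M : ℕ) : ℤ)) (by exact_mod_cast pow_ne_zero M hp.ne_zero) (dn.toGeomPoints dn.derivedPoint)
    simp only at hQ0
    have hkP : ((p : ℤ) ^ (M - t)) • dn.toGeomPoints dn.derivedPoint ∈
        KolyvaginCocycle.invPoints (Field.absoluteGaloisGroup K) dn.pointsSubgroup ((p ^ M : ℕ) : ℤ) :=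
      AddSubgroup.zsmul_mem _ hP _
    have hkQ : ((p ^ M : ℕ) : ℤ) • (((p : ℤ) ^ (M - t)) • Q0) =
        ((p : ℤ) ^ (M - t)) • dn.toGeomPoints dn.derivedPoint := by
      rw [smul_comm, hQ0]
    rw [kolyvaginClass_eq_cls hA hP hQ0, ← cls_zsmul hA _ hP hQ0 ((p : ℤ) ^ (M - t)) hkP hkQ]
    refine cls_eq_zero_of_mem hA _ hkP hkQ ⟨dn.toGeomPoints Q, ⟨Q, rfl⟩, ?_⟩
    have hexp : M - t + min M t = M := by omega
    have hsc : ((p : ℤ) ^ (M - t)) * ((p ^ min M t : ℕ) : ℤ) = ((p ^ M : ℕ) : ℤ) := by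
      push_cast
      rw [← pow_add, hexp]
    rw [← hQ, ← map_zsmul, ← map_zsmul, smul_smul, hsc]
  -- the generator `x₀` and the maximality, in the END's currency
  obtain ⟨x₀, hx₀'⟩ := hM₀div
  have hx₀ : p ^ M₀ • x₀ = P := by rw [← natCast_zsmul]; exact_mod_cast hx₀'
  have hmax : ∀ Q : (W.baseChange K).toAffine.Point, p ^ (M₀ + 1) • Q ≠ P := fun Q hQ ↦
    hM₀max ⟨Q, by rw [← natCast_zsmul] at hQ; exact_mod_cast hQ⟩
  rcases Nat.eq_zero_or_pos M₀ with h0 | hpos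
  · -- `M₀ = 0`: `Ш(E/K)[p^∞] = 0` (x11b3's annihilator END at `m = 0`) and `t = 0` (McCallum Lemma 5.1)
    subst h0
    have ht0 : t = 0 := by
      by_contra ht
      obtain ⟨Q₁, hQ₁⟩ := hglob t le_rfl 1 d₁ squarefree_one (by simp)
      have hP' : Three.Koly.PDiv d₁ p t := ⟨Q₁, hQ₁⟩
      obtain ⟨Q, hQ⟩ := (Three.Koly.pDiv_one_iff_exists_zsmul_eq hK d₁ P hmapP p t
        (fun R hR ↦ RingClassNoTorsion.eq_zero_of_zsmul_pow_eq_zero_ringClassField W hK ι one_ne_zero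
          hp hp2 hρ t R hR)).mp hP'
      refine hM₀max ⟨((p ^ (t - 1) : ℕ) : ℤ) • Q, ?_⟩
      rw [smul_smul, ← Nat.cast_mul, ← pow_add, show 0 + 1 + (t - 1) = t by omega, hQ]
    subst ht0
    have hkill := KolyvaginDischarged.pow_smul_sha_primary_eq_zero_at_of_hGZ_of_prop37
      (N := W.conductorNorm ℤ) (W := W) (K := K) hp hp2 rfl hRcp
      (hγf (W.conductorNorm ℤ) W K p) hE hK hD34 hH hHP hnt hρ (m := 0) hmax
    have hbot : ∀ c ∈ AddCommGroup.primaryComponent (W.baseChange K).sha p, c = 0 := by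
      intro c hc
      obtain ⟨j, hj⟩ := (AddCommGroup.mem_primaryComponent).1 hc
      simpa using hkill c ⟨j, hj⟩
    have hcard : Nat.card (AddCommGroup.primaryComponent (W.baseChange K).sha p) = 1 := by
      rw [Nat.card_eq_one_iff_exists]
      exact ⟨⟨0, zero_mem _⟩, fun c ↦ Subtype.ext (hbot c.1 c.2)⟩
    rw [hcard]
    simp
  -- `M₀ ≥ 1`: the END on the fact's frame, with the Weil pairing at level `p^{2M₀}` and the
  -- Cassels–Tate inputs from `casselsTate_levelInputs`
  haveI : NeZero (p ^ M₀) := ⟨pow_ne_zero _ hp.ne_zero⟩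
  obtain ⟨c, hc1', hcc⟩ := exists_conj_of_isImaginaryQuadratic (K := K) hK
  have h2 : 2 ≤ p ^ M₀ * p ^ M₀ :=
    le_trans (le_trans hp.two_le (Nat.le_self_pow hpos.ne' p)) (Nat.le_mul_of_pos_right _ (NeZero.pos (p ^ M₀)))
  have hq : ((p ^ M₀ * p ^ M₀ : ℕ) : K) ≠ 0 := Nat.cast_ne_zero.mpr (NeZero.ne (p ^ M₀ * p ^ M₀))
  obtain ⟨e, hμ, hadd₁, hadd₂, halt, hnd, hgal⟩ :=
    (W.baseChange K).exists_weilPairing_holds (p ^ M₀ * p ^ M₀) h2 hq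
  obtain ⟨inv, hPT', hH3, hperf, hB, hPτ⟩ := hCTf K W p M₀ hp hp2 hpos c hc1' hcc e hμ hadd₁ hadd₂ hgal halt hnd
  -- (tam3-p1 g9's `card_sha_primary_le_at_of_divT_frame_…` INLINED over x11b3's hGZ-keyed leaf forms, `hGZ := hGZ_of_receptacle hRcp`)
  have hγ : prop37_2_reductionCongruence (W.conductorNorm ℤ) W K p := hγf (W.conductorNorm ℤ) W K p
  exact (card_sha_primary_le_at_of_pointsMDiv_of_reciprocityFinset_of_localDuality W hK hHP hnt hp hp2 hρ hpos
    hc1' hcc hx₀ hmax t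
    (hpoints_at_of_perLevelChoice_of_divT_frame (N := W.conductorNorm ℤ) rfl hK hD34 hH hHP hp hp2 hρ Dt β ι
      d₁.dvd_sq_sub hc1 (KolyvaginLeaves.hCM_holds (W.conductorNorm ℤ) W K p)
      (KolyvaginLeaves.h53_holds (N := W.conductorNorm ℤ) (W := W) rfl p)
      (@fun _ _ _ Dt' β' ι' _ hM _ hn hKol d ↦
        KolyvaginDischarged.hGZ_of_receptacle W (N := W.conductorNorm ℤ) rfl hp hRcp Dt' β' ι' hM hn hKol d)
      (hγ.endBinder (@fun _ ↦ hE) hD34 hp hp2 (@fun _ ↦ hρ) (@fun _ ↦ rfl))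
      t hDivT)
    (@fun _ hM _ hℓ hℓM ↦ KolyvaginReciprocity.kolyvaginReciprocityFinset_of_poitouTate (W.conductorNorm ℤ) W K
      (poitouTate_sum_localTatePairing_eq_zero_holds K) hE hK hD34 hH hHP hnt hp hp2 hρ hM hℓ hℓM)
    e hμ hadd₁ hadd₂ hgal halt hnd inv hPT' (fun v ↦ (hperf v).1.injective) hH3 hB hPτ).2.2.2

end Summit.BirchSwinnertonDyer.Rank1Residual.X11b.KolyvaginOrder

end
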